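import Summits.ResolutionOfSingularities.ResolutionOfSingularities.Theorems.FrobeniusClosingSteerWords15LowLipman
import Summits.ResolutionOfSingularities.ResolutionOfSingularities.Theorems.FrobeniusClosingSteerLowTowerLeaf

/-!
# Crux `Steer` (stmt-ResolutionOfSingularities-16345), line `switching-dichotomy` — WORDS 16A: §σ2.24 THE LOW TOWER INTERFACE (part 1) of the p = 2 σ_top-STEERED COMPOSITION — `IsLowTowerTwo`, D3a `LowTowerExistsTwo` and its 6-line adoption leaf `lowTowerExistsTwo_holds` over res-L0-w41-stub-3's TREE theorem `LowTowerLeaf.exists_isLowTower_of_steeredRun` (p533537) (HOIST of the registered skeleton r41 3f52716f8cdb387f, l.1442–1539, inside `section SteeredTwo`)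

Holder res-L0-w41-lead-1 g5 on res-L0-w41-plan-1 RULING 47 (E1) / 104b; see `…Words01Core` for the hoist protocol (bodies byte for byte;
`[cite: …]` / `[folklore]` tags on CLOSED `def … : Prop` words are written «(ref. …)» / «(folklore)» — GATE NOTE of `…Words02Stubs`;
cite keys inside `[cite:]` tags normalised to `references.bib` keys where needed, as in `…Words03Phases`).
Nothing here is a statement of the manuscript [claim: Hironaka2017, status: under-review]. OURS (candidates / vocabulary; AI review is
weaker than expert review).
-/

open Summit.ResolutionOfSingularities.ResolutionOfSingularities.Theses.FrobeniusClosing (IsolatedForcedTermination)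
open Literature.AlgebraicGeometry.Resolution (IsAbhyankarPlace FGOver exists_ringKrullDim_eq_and_trdeg_eq
  trdeg_eq_trdeg_of_isFractionRing locAtCentre IsQuadraticTransformAlong SubringDominates IsRsopPart
  LocalUniformization3 RelLocalUniformization CossartPiltant2019General)
open Summit.ResolutionOfSingularities.ResolutionOfSingularities.Theorems.SteerRankThinness
  (HasProperCoarsening concl_of_hasProperCoarsening rankOne_of_not_hasProperCoarsening)
open Summit.ResolutionOfSingularities.ResolutionOfSingularities.Theorems.PfaffLine

set_option linter.dupNamespace false

namespace Summit.ResolutionOfSingularities.ResolutionOfSingularities.Theorems.SwitchingDichotomy.Words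

section SteeredTwo

open IsLocalRing
open Literature.AlgebraicGeometry.Resolution (IsLocalBlowupAlong IsQuadraticTransform IsExcellentRing)

variable {K : Type} [Field K]


/-! ### §σ2.24 — THE LOW TOWER INTERFACE AND THE D3 GLUE (res-L0-w41-strat-2, 2026-08-27; plan-1 RULINGS 18d/21b(iv)/24c/27d)

`LowRunTamedMixedBranchTwo` (D3, §σ2.23) = D3a ∘ D3b ∘ D3c ∘ D3d is assembled here from FOUR TOWER-LEVEL Props over ONE interface
predicate `IsLowTowerTwo` (run-free: a family of surface germs `A n`, torsor members `Y n = A n[T n]`, `T n² = h n`, step data `x n, g n`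
and the set `pt` of point stages, all inside ONE field `L` — res-D-pv-012 AS stub-8's D3a design (D3a-SCOPE.md 08:52:21Z; parts 1/2
`…SteerLowTowerMoves` ae741b70447123d5, `…SteerLowTowerTorsor`): `Λ := (R i₀)_{P₀}` (`P₀` the critical-surface prime at the first all-LOW
stage `i₀`, C5′ = res-L0-w41-lead-1 `CriticalSurface.criticalSurfaceFollowed` p514735 keeps every later member inside `Λ`), `φ : Λ → κ(P₀)`,
`A n := φ(R (i₀+n))`, `h n := φ(s_{i₀+n}²)`, `L := κ(P₀)(√h 0)`, `T n := image of s_{i₀+n}`, `pt := {n | IsPointStep R P (i₀+n)}`):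
* D3a `LowTowerExistsTwo` — the run produces such a tower (pv-012; sub-bricks named in its docstring);
* D3b′ `LowTowerPointStepsIOTwo` — a low tower has infinitely many point stages (res-D-pv-007 AS stub-5, p516366/p516773
  `CurveStepCleaning.exists_sq_eq_of_eventual_curveChain_subring` + clauses (T1)(T3)(T5)(T7));
* D3c `LowTowerTamingTwo` — from some stage on every point stage has a NORMAL member (res-type-062: p515973 `CurveLineage` engine +
  `…SteerBadCurveStep`; isolated ⇒ normal by res-type-026 `RadicandChainTwo.isIntegrallyClosed_of_isolated`);
* D3d `LowTowerSingularTwo` — every member is singular (res-L0-w41-stub-3 p516250 `LowStageSingular.not_isRegularLocalRing_of_ringEquiv_adjoinRoot`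
  + clause (T4) + the presentation (T2)/(T3)).
The glue `lowRunTamedMixedBranchTwo_of_pieces` is PROVED below (pure logic); the run-level `LowPointStepsIOTwoN` of §σ2.23 (r29/r30) is
DROPPED at r31 (plan-1 RULING 41 (R3): unconsumed; D3b′ is the tower-level form). OURS; candidates behind the four Props, not facts. -/

/-- **The LOW TOWER interface** (§σ2.24; run-free). Data in one field `L ⊇ k` of characteristic 2: surface germs `A n` (regular local of
dimension 2, essentially of finite type over `k`, residues squares), radicand residues `h n ∈ A n`, torsor generators `T n` (`T n² = h n`),
members `Y n = A n[T n]` (local, essentially of finite type, fraction field `L`), step parameters `x n ∈ 𝔪_{A n} ∖ 0` and cleaners `g n ∈ A n`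
with the laws `h (n+1)·(x n)² = h n − (g n)²`, `T (n+1)·x n = T n − g n`, and the set `pt` of POINT stages. Clauses: (T0) frame of `L`;
(T1) surface germs; (T2) members and their frame + presentation `Y n = closure (A n ∪ {T n})`; (T3) hygiene: `h n` is not the square of a
fraction of `A n` (run: `hirr`); (T4) order descent: `h n − γ² ∈ 𝔪²_{A n}` for some `γ` (every stage singular; stub-3 `exists_sub_pow_mem_sq_map`);
(T5) step data and laws (pv-012 (M3) `map_strictStep`); (T6) POINT stage: `A (n+1)` is the quadratic transform of `A n` in the chart of
`x n` (explicit chart data, pv-012 (M1)) and `Y (n+1)` is a quadratic transform of `Y n` (pv-012 part 2 (T1) `pointStep_isQuadraticTransform`);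
(T7) CURVE stage: `A (n+1) = A n` (pv-012 (M2)), `Y (n+1)` is a proper partial normalisation of `Y n` (pv-012 part 2 (T2)) and NOT a quadratic
transform of it (brick: an integral extension of a 2-dimensional Noetherian local domain is never a quadratic transform — Krull's principal
ideal theorem on the finite ring `Y n[𝔪/x] ⊆ Y (n+1)`); (T9) σ_top READ ON THE SURFACE: at a point stage no height-one prime `Q` of `A n`
with regular quotient carries a singularity of the torsor (`IsSingPrime`, §σ2.1) — run side: a point step means NO permissible centre
(`IsSigmaTopCentre`, second disjunct); a singular `Q` with `A n ⧸ Q` regular lifts to a permissible curve `φ⁻¹ Q ⊂ R n` (regular quotient by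
transport; singular upstairs by the dual-derivation identity `D₁D₂ f ∈ (A n)ˣ` of the LOW shape — brick «Sing of the surface torsor ⊆ Sing of
the member torsor», res-type-072's `CriticalSurface` kit; top-dimensional because `Σ₂ ⊄ Sing` at a point stage, else `P₀`'s transform would be
permissible). No (T8): «infinitely many point stages» is D3b′'s CONCLUSION. OURS. [folklore] -/
def IsLowTowerTwo (k L : Type) [Field k] [Field L] [Algebra k L]
    (A Y : ℕ → Subalgebra k L) (h T x g : ℕ → L) (pt : Set ℕ) : Prop :=
  ∃ (_ : CharP L 2) (hAl : ∀ n, IsLocalRing (A n).toSubring),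
    -- (T0) frame of the field
    Algebra.trdeg k L = 2 ∧
    -- (T1) surface germs
    (∀ n, IsRegularLocalRing (A n).toSubring ∧ ringKrullDim (A n).toSubring = (2 : ℕ) ∧
      Algebra.EssFiniteType k (A n) ∧
      ∀ a : (A n).toSubring, ∃ b : (A n).toSubring, a - b ^ 2 ∈ @maximalIdeal _ _ (hAl n)) ∧
    -- (T2) members, their frame and their presentation
    (∀ n, h n ∈ A n ∧ T n ^ 2 = h n ∧
      (Y n).toSubring = Subring.closure (insert (T n) ((A n : Set L))) ∧
      IsLocalRing (Y n) ∧ Algebra.EssFiniteType k (Y n) ∧ IsFractionRing (Y n) L) ∧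
    -- (T3) hygiene
    (∀ n, ∀ u v : L, u ∈ A n → v ∈ A n → v ≠ 0 → (u / v) ^ 2 ≠ h n) ∧
    -- (T4) order descent
    (∀ n (hh : h n ∈ A n), ∃ γ : (A n).toSubring,
      (⟨h n, hh⟩ : (A n).toSubring) - γ ^ 2 ∈ (@maximalIdeal _ _ (hAl n)) ^ 2) ∧
    -- (T5) step data and laws
    (∀ n, g n ∈ A n ∧ x n ≠ 0 ∧ (∃ hx : x n ∈ A n, (⟨x n, hx⟩ : (A n).toSubring) ∈ @maximalIdeal _ _ (hAl n)) ∧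
      h (n + 1) * x n ^ 2 = h n - g n ^ 2 ∧ T (n + 1) * x n = T n - g n) ∧
    -- (T6) point stages
    (∀ n ∈ pt,
      @Literature.AlgebraicGeometry.Resolution.blowupRing _ _ (A n).toSubring (hAl n) (x n) ≤ (A (n + 1)).toSubring ∧
      (∀ z ∈ A (n + 1), ∃ a ∈ @Literature.AlgebraicGeometry.Resolution.blowupRing _ _ (A n).toSubring (hAl n) (x n),
        ∃ b ∈ @Literature.AlgebraicGeometry.Resolution.blowupRing _ _ (A n).toSubring (hAl n) (x n), b⁻¹ ∈ A (n + 1) ∧ z = a / b) ∧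
      SubringDominates (A n).toSubring (A (n + 1)).toSubring ∧
      IsQuadraticTransform (Y n).toSubring (Y (n + 1)).toSubring) ∧
    -- (T7) curve stages
    (∀ n ∉ pt, A (n + 1) = A n ∧ IsPartialNormalisation (Y n).toSubring (Y (n + 1)).toSubring ∧
      ¬ IsQuadraticTransform (Y n).toSubring (Y (n + 1)).toSubring) ∧
    -- (T9) σ_top read on the surface
    (∀ n ∈ pt, ∀ (Q : Ideal (A n).toSubring) [Q.IsPrime], Q ≠ ⊥ → Q ≠ @maximalIdeal _ _ (hAl n) →
      IsRegularLocalRing ((A n).toSubring ⧸ Q) →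
      ∀ hh : h n ∈ A n, ¬ IsSingPrime (A n).toSubring 2 ⟨h n, hh⟩ Q)

/-- **D3a · LowTowerExistsTwo** (L; res-D-pv-012 AS stub-8: D3a-SCOPE + `…SteerLowTowerMoves` (M1)–(M3) + `…SteerLowTowerTorsor` (T1)/(T2)
+ (M4)/(M5); named sub-bricks for other hands: (T7c) «integral ⇒ not a quadratic transform» and (T9) «point step ⇒ no singular regular curve on
the surface» — see `IsLowTowerTwo`): along a normalised 2-steered run from the core datum that is LOW from some stage on, given the LOW inputs
(dual derivations at every member, the rank-4 exit B7, the surface-step exit C8), there is a LOW TOWER in the sense of `IsLowTowerTwo` over the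
ORIGINAL `k`. Construction: `i₀` := first all-LOW stage, `P₀` := the critical-surface prime of `R i₀` (§σ2.5′, needs the duals), `Λ := (R i₀)_{P₀}`,
C5′ keeps `R n ≤ Λ`, `φ : Λ → κ(P₀)`, `A n := φ(R (i₀+n))`, `h n := φ(s²)`, `L := κ(P₀)[√h 0]` (a field by (T3) at `n = 0`: `h̄` a square in
`κ(P₀)` would put `Σ₂ ⊆ Sing`, a surface step, C8), `T n :=` the image of `s_{i₀+n}` under `φ` extended to `Λ[s_{i₀}] ∋ s_n` (the `x_n` are
`Λ`-units), `pt := {n | IsPointStep R P (i₀+n)}`; B7 excludes the rank-4 shape so the LOW normal form `s² − g² = l₁l₂ + c` with duals is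
available at every stage (C1/C2 p511593). Why it might fail: only mis-transcription of a clause; each clause is a named lemma of the hands
above. OURS. (ref. Cutkosky2014, §2.1) (ref. Lipman1978, (1.32)) (folklore) -/
def LowTowerExistsTwo : Prop :=
  MembersDualDerivationsTwoN → RankFourExitTwo → LowSurfaceStepExitsTwo →
  ∀ p : ℕ, p = 2 →
    ∀ (k K : Type) [Field k] [CharP k p] [PerfectField k] [Field K] [Algebra k K]
    (O : ValuationSubring K) (A₀ : Subalgebra k K) (h₀ : A₀.toSubring ≤ O.toSubring) (t : K),
    CoreDatum p 4 k K O A₀ h₀ t → ¬ HasProperCoarsening O →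
    ∀ (R : ℕ → Subring K) (P : (i : ℕ) → Ideal (R i)) (s : ℕ → K),
      R 0 = locAtCentre A₀.toSubring O → NormalAt O (R 0) p t → IsSteeredRun O R P t p s →
      (∃ i₀ : ℕ, ∀ i, i₀ ≤ i → ¬ IsHighOrderAt R s p i) →
      ∃ (L : Type) (_ : Field L) (_ : Algebra k L) (A Y : ℕ → Subalgebra k L) (h T x g : ℕ → L) (pt : Set ℕ),
        IsLowTowerTwo k L A Y h T x g pt

/-- **D3a holds** (ADOPTION LEAF over res-L0-w41-stub-3's tree theorem `LowTowerLeaf.exists_isLowTower_of_steeredRun`, p533537 ✓ — the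
118-line leaf of r39/r40 moved into the tree; the three antecedents, `NormalAt` and `¬ HasProperCoarsening` are not consumed). OURS. [folklore] -/
theorem lowTowerExistsTwo_holds : LowTowerExistsTwo := by
  intro _ _ _ p hp k K _ _ _ _ _ O A₀ h₀ t core _ R P s hR0 _ hrun hlow
  exact _root_.Summit.ResolutionOfSingularities.ResolutionOfSingularities.Theorems.SwitchingDichotomy.LowTowerLeaf.exists_isLowTower_of_steeredRun
    p hp k K O A₀ h₀ t core R P s hR0 hrun hlow

end SteeredTwo

end Summit.ResolutionOfSingularities.ResolutionOfSingularities.Theorems.SwitchingDichotomy.Words
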